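import Summits.QuantumFields.BalabanUV.Beta.D1BFx.CrossERest
import Summits.QuantumFields.BalabanUV.Beta.D1BFx.SplitRecut

/-!
# `BalabanUV.Beta.D1BFx.CrossERecut` — road «BF-x» for binder row D1, slot (REST): THE RE-CUT crossE WORD — over the TRANSVERSE-COMPLETED E-sector
# `SbE − DIVₐ = VEC + REMₐ` the E×E frozen cross word is `VEC×REMₐ + REMₐ×VEC + REMₐ×REMₐ` ONLY (three words of total grading ≥ 3, NO longitudinal word):
# its exact identification `crossE′ = remK₃`, the A2 bound `|fullSum remK₃| ≤ |ω_gl·cE²|·n⁻⁸·(80·A)`, (CONV), and the packaged (REST) binder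

HONEST DEPENDENCY (page 1, mandatory): continuum YM on T⁴ ⇐ BetaPertH ∧ nine spine estimates (0/9 proved); BetaPertH ⇐ (D1) ∧ (D4) ∧
CAP+tail; G-an2-4 gates asym, D1 and NE2/3/4.  HONEST FRAMING (cell contract, verbatim): «discharging `BetaPertH` makes Bałaban's UV
stability UNCONDITIONAL — a real constructive-QFT result; it is NOT the continuum limit and NOT the Clay problem.»  THIS MODULE DISCHARGES
NOTHING of the wall: TWO definitions with bodies ([our objects] `remW₃`, `remK₃`) and [folklore] re-instantiation BY NAME of my `CrossERestLists` ∕ `CrossERest`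
machinery (an3's `GradedBubbles.isO_seven`, leaf-07's `DegreeSevenCount`, the owner's bridge) on THREE words instead of five.  No `Prop` minted, nothing cited,
0 sorry.  0 wall binders; NOT the (K) slot, NOT A3.a, NOT D1, NOT `BetaPertH`, NOT continuum, NOT Clay.

ABSOLUTE RULE (cell charter, verbatim): «No internally-minted statement may enter as a cited fact. Every hypothesis is either kernel-proved in
this package or a verbatim quotation of a PUBLISHED theorem with page reference. The manuscript(s) under audit are NOT citable for their own
disputed steps — they are the thing under adjudication; programme-internal (2001/route/tribunal) claims are never citable.»

WHY (road owner d1-p2-g3, OWNER FINDING «D1-BFx-LON-MISCUT» + RESHAPE, journal 2026-08-20 15:31Z: «sector RE-CUT with the SAME total stencil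
`cE•SbE + cΛ•SbL + cR•SbR = cE•SbT + cΛ•SbL + 1•SbRc`, `divK κ u := realK u u (reixStn ιU (div₀ κ))`, `SbT := SbE − divK` (= VEC + REMₐ), `SbRc := cR•SbR + cE•divK`;
crossE′ := cE²·[SbT×SbT − VEC×VEC]_frozen = VEC×REMₐ + REMₐ×VEC + REMₐ×REMₐ ⊂ remW (O(7), leaf-03-g4's `abs_fullSum_remK_le` machinery applies; `lonK` DISAPPEARS)»).
The landed cut (`SplitInstance.restK`, crossE = `lonK + remK`, `CrossERest`) separates the three LONGITUDINAL words `lonK` (grading 2, `IsO 6`, log-carrying)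
from their Feynman-completion partners in the R-sector words; the owner's re-cut moves `DIVₐ` into the R-sector, so the E×E frozen cross word of the re-cut list is
log-free ENTIRELY.  THIS FILE supplies the (REST)∕(CONV) members for that word of the owner's `SplitRecut.restK'` (p223937; index `Sum.inr (Sum.inr (Sum.inr (Sum.inr 1)))`),
reading his `SectorRecut.SbT = SbE − divK` (p223770) as ONE list `vec₀ κ ++ rem₀ κ` (`realK_reix_vec₀_rem₀`), and the word's (REST′) hypothesis of
`RoadEndBFxRecut.d1Drift_BFx_recut` (p224363) PACKAGED from a `DG 3 2` leg family + membership + the END's own `hlam` (weight `|ω_gl·cE²|·n⁻⁸ = 2N²`):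
* §1 [our object] `remW₃`; [folklore] `realK_reix_vec₀_rem₀`, `bub_SbT_sub_bub_vec₀` (`bub (vec₀++rem₀)(vec₀++rem₀) − bub vec₀ vec₀ = remW₃`), `isO_seven_remW₃`,
  `exists_decay_remW₃`, `remW₃_apply_eq_const`, `remW₃_const_apply_eq_zero_idx`, `exists_envelope_remW₃`.
* §2 [our object] `remK₃`; [folklore] `crossE'_eq_remK₃` (list level), **`restK'_crossE_eq_remK₃`** (the owner's re-cut word at base site `b` IS `remK₃`, as
  functions of `w`), `abs_remK₃_le_quintic`, **`abs_fullSum_remK₃_le`**, `conv_remK₃_of_decay`, `conv_remK₃` (fixed n, exponential bound only),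
  `abs_avg_fullSum_remK₃_le`, **`hR_remK₃_packaged`** ∕ `hR_remK₃_packaged_of_weight`, `hKr_remK₃_packaged`.
* §3 [folklore] `weight_eq_of_hlam` (`ω_gl·cE² = 2N²·n⁸ ⇒ |ω_gl·cE²|·n⁻⁸ = 2N²`), **`hRest_crossE'_packaged`**: the END's (REST′) line for the cross word,
  `∃ A ≥ 0, ∀ n ≥ 2, |Σ_b n⁻⁴·fullSum (restK' n a (gp n b) … (n⁸) N μ ν b crossE′)| ≤ 2N²·(80·A)`, from `DG 3 2 G` + membership + `hlam`.
Unit `b2b-balaban-beta-d1-formalise-leaf-03` (gen 4), D1 formalisation swarm; `LEAVES-BFx.md` row A2 ∕ (REST) (sub-leaf «D1-BFx-REST-crossE′»).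
-/

noncomputable section

namespace Summit.QuantumFields.BalabanUV.Beta.D1BFx.CrossERecut

open Finset Filter Topology
open scoped BigOperators
open Literature.Probability.LatticeModels (annulus)
open Literature.MathematicalPhysics.QuantumFieldTheory.Balaban1983to89
open Literature.MathematicalPhysics.QuantumFieldTheory.Balaban1983to89.Beta
open B12Sec2to5 (l1 l1_nonneg Decay510)
open ExpKernelCalculus (Site MKer bubble)
open DyadicShell (Pt toReal supNorm supNorm_eq_of_mem_sphere ne_zero_of_mem_annulus)
open BubbleTransfer (abs_moment_le)
open WindowIdentification (psum fullSum)
open DressedMomentNormalisation (resSite)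
open GradedBubbles (Fam IsO DG Stn bub bub_append_left bub_append_right isO_seven supNorm_neg)
open Summit.QuantumFields.BalabanUV.Beta.D1BFx.GluonKernelSectors (SbE)
open Summit.QuantumFields.BalabanUV.Beta.D1BFx.StencilRealisation (realK)
open Summit.QuantumFields.BalabanUV.Beta.D1BFx.WilsonStencilRealised (reixStn ιU realK_append)
open Summit.QuantumFields.BalabanUV.Beta.D1BFx.ColourlessAntisymmetry (reixStn_append)
open Summit.QuantumFields.BalabanUV.Beta.D1BFx.MainTable (vecK)
open Summit.QuantumFields.BalabanUV.Beta.D1BFx.FineHessianLegGrades (frozenLeg)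
open Summit.QuantumFields.BalabanUV.Beta.D1BFx.Assembly (sum_uniform_resSite uniform_resSite_nonneg)
open Summit.QuantumFields.BalabanUV.Beta.D1BFx.ContactCount (abs_sum_mul_le_of_convex)
open Summit.QuantumFields.BalabanUV.Beta.D1BFx.DegreeSevenCount (abs_fullSum_le_of_quintic exists_tendsto_psum_of_quintic)
open Summit.QuantumFields.BalabanUV.Beta.D1BFx.CrossERestLists
open Summit.QuantumFields.BalabanUV.Beta.D1BFx.CrossERest (bubble_frozen_reix conv_of_envelope)
open Summit.QuantumFields.BalabanUV.Beta.D1BFx.ReducedKernel (TableR)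
open Summit.QuantumFields.BalabanUV.Beta.D1BFx.SplitInstance (RestIdx)
open Summit.QuantumFields.BalabanUV.Beta.D1BFx.SectorRecut (divK SbT SbT_apply)
open Summit.QuantumFields.BalabanUV.Beta.D1BFx.SplitRecut (restK' restK'_crossE)

/-! ## §1 The three remainder words of the re-cut E-sector -/

/-- [our object] **THE THREE REMAINDER CROSS WORDS OF THE TRANSVERSE-COMPLETED E-SECTOR** (total grading ≥ 3 each; NO longitudinal word):
`remW₃ f μ ν := bub vec₀μ rem₀ν + bub rem₀μ vec₀ν + bub rem₀μ rem₀ν`. -/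
def remW₃ (f : Fam) (μ ν : Fin 4) : Fam :=
  bub f f (vec₀ μ) (rem₀ ν) + bub f f (rem₀ μ) (vec₀ ν) + bub f f (rem₀ μ) (rem₀ ν)

/-- [folklore] **THE OWNER'S TRANSVERSE-COMPLETED E-STENCIL AS ONE LIST**: `SbE κ u − divK κ u = realK u u (reixStn ιU (vec₀ κ ++ rem₀ κ))` with
`divK κ u = realK u u (reixStn ιU (div₀ κ))`. -/
theorem realK_reix_vec₀_rem₀ (κ : Fin 4) (u : Pt) :
    SbE κ u - realK u u (reixStn ιU (div₀ κ)) = realK u u (reixStn ιU (vec₀ κ ++ rem₀ κ)) := by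
  rw [SbE_eq_realK_lists, reixStn_append, reixStn_append, reixStn_append, realK_append, realK_append, realK_append]
  abel

/-- [folklore] **THE SPLIT**: `bub (vec₀++rem₀)μ (vec₀++rem₀)ν − bub vec₀μ vec₀ν = remW₃` (bilinearity of an3's `bub`). -/
theorem bub_SbT_sub_bub_vec₀ (f : Fam) (μ ν : Fin 4) :
    bub f f (vec₀ μ ++ rem₀ μ) (vec₀ ν ++ rem₀ ν) - bub f f (vec₀ μ) (vec₀ ν) = remW₃ f μ ν := by
  simp only [bub_append_left, bub_append_right, remW₃]
  abel

/-- [folklore] **THE THREE WORDS ARE `IsO 7`** through any leg family with the budget `DG 3 2` (gradings (1,2), (2,1), (2,2)). -/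
theorem isO_seven_remW₃ {f : Fam} (hf : DG 3 2 f) (μ ν : Fin 4) : IsO 7 (remW₃ f μ ν) :=
  ((isO_seven (graded_vec₀ μ) (graded_rem₀ ν) (by norm_num) hf hf).add
    (isO_seven (graded_rem₀ μ) (graded_vec₀ ν) (by norm_num) hf hf)).add
    (isO_seven (graded_rem₀ μ) (graded_rem₀ ν) (by norm_num) hf hf)

/-- [folklore] `IsO 7` made explicit. -/
theorem exists_decay_remW₃ {f : Fam} (hf : DG 3 2 f) (μ ν : Fin 4) :
    ∃ A : ℝ, 0 ≤ A ∧ ∀ (L k : ℕ) (w : Pt), w ≠ 0 → |remW₃ f μ ν L k w| ≤ A / (supNorm w : ℝ) ^ 7 := by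
  obtain ⟨A, hA, -, hdec⟩ := isO_seven_remW₃ hf μ ν
  exact ⟨A, hA, hdec⟩

/-- [folklore] A family's word at `(L, k)` is the constant-leg word of its `(L, k)` member. -/
theorem remW₃_apply_eq_const (f : Fam) (μ ν : Fin 4) (L k : ℕ) (w : Pt) : remW₃ f μ ν L k w = remW₃ (fun _ _ => f L k) μ ν L k w := by
  simp only [remW₃, Pi.add_apply, bub_apply_eq_const f f]

/-- [folklore] A constant-leg word does not see the dummy indices `(L, k)`. -/
theorem remW₃_const_apply_eq_zero_idx (g : Pt → ℝ) (μ ν : Fin 4) (L k : ℕ) (w : Pt) :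
    remW₃ (fun _ _ => g) μ ν L k w = remW₃ (fun _ _ => g) μ ν 0 0 w := by
  simp only [remW₃, Pi.add_apply]
  rw [bub_const_apply_eq_zero_idx g g (vec₀ μ) (rem₀ ν) L k w, bub_const_apply_eq_zero_idx g g (rem₀ μ) (vec₀ ν) L k w,
    bub_const_apply_eq_zero_idx g g (rem₀ μ) (rem₀ ν) L k w]

/-- [folklore] The exponential envelope of the three words at a fixed exponentially bounded leg (for (CONV)). -/
theorem exists_envelope_remW₃ {g : Pt → ℝ} {C δ : ℝ} (hδ : 0 ≤ δ) (hg : ∀ v, |g v| ≤ C * Real.exp (-δ * l1 v)) (μ ν : Fin 4) :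
    ∃ C' : ℝ, 0 ≤ C' ∧ ∀ (L k : ℕ) (w : Pt), |remW₃ (fun _ _ => g) μ ν L k w| ≤ C' * Real.exp (-δ * l1 w) := by
  unfold remW₃
  exact exists_envelope_add (exists_envelope_add (exists_envelope_bub hδ hg _ _) (exists_envelope_bub hδ hg _ _)) (exists_envelope_bub hδ hg _ _)

/-! ## §2 The re-cut crossE word: identification, bound, (CONV), packaging -/

/-- [our object] **THE RE-CUT crossE INTEGRAND**: `remK₃ n g cE ω_gl μ ν w := ω_gl·(cE·cE·(n⁻⁸·(w_μw_ν·(−½·remW₃ g μ ν 0 0 (−w)))))`.  A DEFINITION. -/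
def remK₃ (n : ℕ) (g : Pt → ℝ) (cE ωgl : ℝ) (μ ν : Fin 4) : Pt → ℝ := fun w =>
  ωgl * (cE * cE * (((n : ℝ) ^ 8)⁻¹ * (toReal w μ * toReal w ν * (-(1 / 2 : ℝ) * remW₃ (fun _ _ => g) μ ν 0 0 (-w)))))

section Word

variable (n : ℕ) (g : Pt → ℝ) (cE ωgl : ℝ) (μ ν : Fin 4) (b : Pt)

/-- [folklore] **THE RE-CUT crossE WORD IS `remK₃`**: with the transverse-completed stencil realised as `T κ u := realK u u (reixStn ιU (vec₀ κ ++ rem₀ κ))`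
(`= SbE κ u − divK κ u`), the weighted frozen cross word `ω_gl·(cE·cE·(n⁻⁸·(w_μw_ν·(−½·(bubble A (T μ (b+w)) (T ν b) − bubble A (vecK μ (b+w)) (vecK ν b))))))`,
`A = frozenLeg g`, equals `remK₃ n g cE ω_gl μ ν w` — the base site enters only through `g`. -/
theorem crossE'_eq_remK₃ (w : Pt) :
    ωgl * (cE * cE * (((n : ℝ) ^ 8)⁻¹ * (toReal w μ * toReal w ν * (-(1 / 2 : ℝ) *
      (bubble (frozenLeg g : MKer 4 (Fin 4)) (realK (b + w) (b + w) (reixStn ιU (vec₀ μ ++ rem₀ μ))) (realK b b (reixStn ιU (vec₀ ν ++ rem₀ ν)))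
        - bubble (frozenLeg g : MKer 4 (Fin 4)) (vecK μ (b + w)) (vecK ν b)))))) = remK₃ n g cE ωgl μ ν w := by
  rw [vecK_eq_realK_vec₀, vecK_eq_realK_vec₀, bubble_frozen_reix g _ _ b w 0 0, bubble_frozen_reix g _ _ b w 0 0, ← Pi.sub_apply, ← Pi.sub_apply,
    ← Pi.sub_apply, bub_SbT_sub_bub_vec₀]
  rfl

/-- [folklore] **THE OWNER'S RE-CUT crossE WORD IS `remK₃`** (as functions of the displacement): for every parameter list,
`(w ↦ restK' n a g cE … ω_gl ω_gh lam N μ ν b (inr (inr (inr (inr 1)))) w) = remK₃ n g cE ω_gl μ ν` — `SplitRecut.restK'_crossE`, `SectorRecut.SbT_apply`,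
`divK`, `realK_reix_vec₀_rem₀`, `crossE'_eq_remK₃`. -/
theorem restK'_crossE_eq_remK₃ [NeZero n] (a cΛ cR cK cQ cE₂ cJ4 cΛ₂ cR₂ cQ₂ x₀ : ℝ) (WE WJ WΛ WR WQ : TableR) (ωgh lam N : ℝ) :
    (fun w : Pt => restK' n a g cE cΛ cR cK cQ cE₂ cJ4 cΛ₂ cR₂ cQ₂ x₀ WE WJ WΛ WR WQ ωgl ωgh lam N μ ν b (Sum.inr (Sum.inr (Sum.inr (Sum.inr 1)))) w) =
      remK₃ n g cE ωgl μ ν := by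
  funext w
  rw [restK'_crossE, SbT_apply, SbT_apply]
  simp only [divK]
  rw [realK_reix_vec₀_rem₀, realK_reix_vec₀_rem₀]
  exact crossE'_eq_remK₃ n g cE ωgl μ ν b w

end Word

section Bound

variable (n : ℕ) {g : Pt → ℝ} (cE ωgl : ℝ) (μ ν : Fin 4) {A : ℝ}

/-- [folklore] SHELLWISE: a degree-7 decay of `remW₃ g μ ν` makes `remK₃` quintic on every shell. -/
theorem abs_remK₃_le_quintic (hdec : ∀ w : Pt, w ≠ 0 → |remW₃ (fun _ _ => g) μ ν 0 0 w| ≤ A / (supNorm w : ℝ) ^ 7)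
    (r : ℕ) (w : Pt) (hw : w ∈ annulus 4 r (r + 1)) :
    |remK₃ n g cE ωgl μ ν w| ≤ |ωgl * (cE * cE)| * ((n : ℝ) ^ 8)⁻¹ * ((1 / 2 : ℝ) * A) / ((r : ℝ) + 1) ^ 5 := by
  have hw0 : w ≠ 0 := ne_zero_of_mem_annulus hw
  have hs : (supNorm w : ℝ) = (r : ℝ) + 1 := by rw [supNorm_eq_of_mem_sphere hw]; push_cast; ring
  have hr1 : (0 : ℝ) < (r : ℝ) + 1 := by positivity
  have hmom : |toReal w μ * toReal w ν| ≤ ((r : ℝ) + 1) ^ 2 := by rw [← hs]; exact abs_moment_le μ ν w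
  have hrem : |remW₃ (fun _ _ => g) μ ν 0 0 (-w)| ≤ A / ((r : ℝ) + 1) ^ 7 := by
    have h := hdec (-w) (neg_ne_zero.mpr hw0)
    rwa [supNorm_neg, hs] at h
  have e : remK₃ n g cE ωgl μ ν w =
      (ωgl * (cE * cE)) * ((n : ℝ) ^ 8)⁻¹ * (-(1 / 2 : ℝ)) * ((toReal w μ * toReal w ν) * remW₃ (fun _ _ => g) μ ν 0 0 (-w)) := by
    simp only [remK₃]; ring
  rw [e, abs_mul, abs_mul, abs_mul, abs_mul (toReal w μ * toReal w ν), abs_of_nonneg (by positivity : (0 : ℝ) ≤ ((n : ℝ) ^ 8)⁻¹),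
    show |(-(1 / 2 : ℝ))| = 1 / 2 by norm_num]
  have hn0 : 0 ≤ |ωgl * (cE * cE)| * ((n : ℝ) ^ 8)⁻¹ * (1 / 2 : ℝ) := by positivity
  calc |ωgl * (cE * cE)| * ((n : ℝ) ^ 8)⁻¹ * (1 / 2) * (|toReal w μ * toReal w ν| * |remW₃ (fun _ _ => g) μ ν 0 0 (-w)|)
      ≤ |ωgl * (cE * cE)| * ((n : ℝ) ^ 8)⁻¹ * (1 / 2) * (((r : ℝ) + 1) ^ 2 * (A / ((r : ℝ) + 1) ^ 7)) :=
        mul_le_mul_of_nonneg_left (mul_le_mul hmom hrem (abs_nonneg _) (by positivity)) hn0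
    _ = |ωgl * (cE * cE)| * ((n : ℝ) ^ 8)⁻¹ * ((1 / 2 : ℝ) * A) / ((r : ℝ) + 1) ^ 5 := by
        field_simp

/-- [folklore] **THE A2 BOUND FOR THE RE-CUT crossE WORD**: `|fullSum (remK₃ n g cE ω_gl μ ν)| ≤ |ω_gl·(cE·cE)|·n⁻⁸·(80·A)`. -/
theorem abs_fullSum_remK₃_le (hA : 0 ≤ A) (hdec : ∀ w : Pt, w ≠ 0 → |remW₃ (fun _ _ => g) μ ν 0 0 w| ≤ A / (supNorm w : ℝ) ^ 7) :
    |fullSum (remK₃ n g cE ωgl μ ν)| ≤ |ωgl * (cE * cE)| * ((n : ℝ) ^ 8)⁻¹ * (80 * A) := by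
  have h := abs_fullSum_le_of_quintic (K := remK₃ n g cE ωgl μ ν) (C := |ωgl * (cE * cE)| * ((n : ℝ) ^ 8)⁻¹ * ((1 / 2 : ℝ) * A))
    (by positivity) (fun r w hw => abs_remK₃_le_quintic n cE ωgl μ ν hdec r w hw)
  refine h.trans (le_of_eq ?_)
  ring

/-- [folklore] (CONV) for the re-cut word from the degree-7 decay. -/
theorem conv_remK₃_of_decay (hA : 0 ≤ A) (hdec : ∀ w : Pt, w ≠ 0 → |remW₃ (fun _ _ => g) μ ν 0 0 w| ≤ A / (supNorm w : ℝ) ^ 7) :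
    ∃ B, Tendsto (psum (remK₃ n g cE ωgl μ ν)) atTop (𝓝 B) :=
  exists_tendsto_psum_of_quintic (C := |ωgl * (cE * cE)| * ((n : ℝ) ^ 8)⁻¹ * ((1 / 2 : ℝ) * A)) (by positivity)
    (fun r w hw => abs_remK₃_le_quintic n cE ωgl μ ν hdec r w hw)

/-- [folklore] **(CONV) AT FIXED `n` FROM THE PROFILE'S EXPONENTIAL BOUND ALONE** (`δ > 0`). -/
theorem conv_remK₃ {C δ : ℝ} (hδ : 0 < δ) (hg : ∀ v, |g v| ≤ C * Real.exp (-δ * l1 v)) :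
    ∃ B, Tendsto (psum (remK₃ n g cE ωgl μ ν)) atTop (𝓝 B) := by
  have h := conv_of_envelope μ ν hδ (exists_envelope_remW₃ hδ.le hg μ ν) (ωgl * (cE * cE) * ((n : ℝ) ^ 8)⁻¹ * (-(1 / 2 : ℝ)))
  have e : remK₃ n g cE ωgl μ ν = fun w : Pt =>
      ωgl * (cE * cE) * ((n : ℝ) ^ 8)⁻¹ * (-(1 / 2 : ℝ)) * (toReal w μ * toReal w ν * remW₃ (fun _ _ => g) μ ν 0 0 (-w)) := by
    funext w; simp only [remK₃]; ring
  rwa [e]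

end Bound

section Average

variable (n : ℕ) [NeZero n] {gb : Pt → Pt → ℝ} (cE ωgl : ℝ) (μ ν : Fin 4) {A : ℝ}

/-- [folklore] **BASE-POINT AVERAGE AT FIXED `n`** (convex uniform weights): one degree-7 constant for every base site's profile gives
`|Σ_{b ∈ image resSite} n⁻⁴·fullSum (remK₃ n (gb b) cE ω_gl μ ν)| ≤ |ω_gl·(cE·cE)|·n⁻⁸·(80·A)`. -/
theorem abs_avg_fullSum_remK₃_le (hA : 0 ≤ A)
    (hdec : ∀ b ∈ (univ : Finset (Fin 4 → Fin n)).image resSite, ∀ w : Pt, w ≠ 0 → |remW₃ (fun _ _ => gb b) μ ν 0 0 w| ≤ A / (supNorm w : ℝ) ^ 7) :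
    |∑ b ∈ (univ : Finset (Fin 4 → Fin n)).image resSite, ((n : ℝ) ^ 4)⁻¹ * fullSum (remK₃ n (gb b) cE ωgl μ ν)| ≤
      |ωgl * (cE * cE)| * ((n : ℝ) ^ 8)⁻¹ * (80 * A) :=
  abs_sum_mul_le_of_convex _ (fun b hb => uniform_resSite_nonneg n b hb) (sum_uniform_resSite (NeZero.ne n))
    fun b hb => abs_fullSum_remK₃_le n cE ωgl μ ν hA (hdec b hb)

end Average

section Packaged

variable {gp : ℕ → Pt → Pt → ℝ} {cE ωgl : ℕ → ℝ} {μ ν : Fin 4}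

/-- [folklore] **(CONV) FOR THE RE-CUT WORD, PACKAGED** (from the owner's profile hypothesis `hg`). -/
theorem hKr_remK₃_packaged (hg : ∀ n : ℕ, 2 ≤ n → ∀ b : Pt, ∃ C δ : ℝ, 0 < δ ∧ ∀ v, |gp n b v| ≤ C * Real.exp (-δ * l1 v)) :
    ∀ n : ℕ, 2 ≤ n → ∀ b ∈ (univ : Finset (Fin 4 → Fin n)).image resSite, ∃ B,
      Tendsto (psum (remK₃ n (gp n b) (cE n) (ωgl n) μ ν)) atTop (𝓝 B) := by
  intro n hn b _
  obtain ⟨C, δ, hδ, hgb⟩ := hg n hn b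
  exact conv_remK₃ n (cE n) (ωgl n) μ ν hδ hgb

/-- [folklore] **THE (REST) BINDER FOR THE RE-CUT crossE WORD — A2 CLASS, EVERY BLOCK SIZE, ONE CONSTANT** from a leg FAMILY `G` with an3's budget
`DG 3 2 G` and membership `gp n b = G n (e n b)`:
`∃ A ≥ 0, ∀ n ≥ 2, |Σ_{b ∈ image resSite} n⁻⁴·fullSum (remK₃ n (gp n b) (cE n) (ω_gl n) μ ν)| ≤ |ω_gl n·(cE n·cE n)|·n⁻⁸·(80·A)`. -/
theorem hR_remK₃_packaged {G : Fam} (hG : DG 3 2 G) {e : ℕ → Pt → ℕ}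
    (hmem : ∀ n : ℕ, 2 ≤ n → ∀ b ∈ (univ : Finset (Fin 4 → Fin n)).image resSite, gp n b = G n (e n b)) :
    ∃ A : ℝ, 0 ≤ A ∧ ∀ n : ℕ, 2 ≤ n →
      |∑ b ∈ (univ : Finset (Fin 4 → Fin n)).image resSite, ((n : ℝ) ^ 4)⁻¹ * fullSum (remK₃ n (gp n b) (cE n) (ωgl n) μ ν)| ≤
        |ωgl n * (cE n * cE n)| * ((n : ℝ) ^ 8)⁻¹ * (80 * A) := by
  obtain ⟨A, hA, hdec⟩ := exists_decay_remW₃ hG μ ν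
  refine ⟨A, hA, fun n hn => ?_⟩
  haveI : NeZero n := ⟨Nat.one_le_iff_ne_zero.mp (le_trans one_le_two hn)⟩
  refine abs_avg_fullSum_remK₃_le n (cE n) (ωgl n) μ ν hA fun b hb w hw => ?_
  rw [hmem n hn b hb, ← remW₃_const_apply_eq_zero_idx (G n (e n b)) μ ν n (e n b) w, ← remW₃_apply_eq_const]
  exact hdec n (e n b) w hw

/-- [folklore] … AND UNDER THE DISPLAYED WEIGHT INEQUALITY `|ω_gl n·(cE n·cE n)|·n⁻⁸ ≤ Ω` (slot (K)): `≤ Ω·(80·A)`. -/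
theorem hR_remK₃_packaged_of_weight {G : Fam} (hG : DG 3 2 G) {e : ℕ → Pt → ℕ}
    (hmem : ∀ n : ℕ, 2 ≤ n → ∀ b ∈ (univ : Finset (Fin 4 → Fin n)).image resSite, gp n b = G n (e n b)) {Ω : ℝ}
    (hΩ : ∀ n : ℕ, 2 ≤ n → |ωgl n * (cE n * cE n)| * ((n : ℝ) ^ 8)⁻¹ ≤ Ω) :
    ∃ A : ℝ, 0 ≤ A ∧ ∀ n : ℕ, 2 ≤ n →
      |∑ b ∈ (univ : Finset (Fin 4 → Fin n)).image resSite, ((n : ℝ) ^ 4)⁻¹ * fullSum (remK₃ n (gp n b) (cE n) (ωgl n) μ ν)| ≤ Ω * (80 * A) := by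
  obtain ⟨A, hA, h⟩ := hR_remK₃_packaged (cE := cE) (ωgl := ωgl) (μ := μ) (ν := ν) hG hmem
  exact ⟨A, hA, fun n hn => (h n hn).trans (mul_le_mul_of_nonneg_right (hΩ n hn) (by positivity))⟩

end Packaged

/-! ## §3 The END's (REST′) line for the cross word -/

section RoadEnd

/-- [folklore] The END's normalisation `ω_gl·cE² = 2N²·lam` at `lam = n⁸` pins the cross word's weight: `|ω_gl·(cE·cE)|·n⁻⁸ = 2N²` (`n ≠ 0`). -/
theorem weight_eq_of_hlam {n : ℕ} (hn : n ≠ 0) {ωgl cE N : ℝ} (hlam : ωgl * cE ^ 2 = 2 * N ^ 2 * (n : ℝ) ^ 8) :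
    |ωgl * (cE * cE)| * ((n : ℝ) ^ 8)⁻¹ = 2 * N ^ 2 := by
  have h8 : (0 : ℝ) < (n : ℝ) ^ 8 := by positivity
  rw [← sq, hlam, abs_of_nonneg (by positivity), mul_inv_eq_iff_eq_mul₀ h8.ne']

variable {a : ℝ} {gp : ℕ → Pt → Pt → ℝ} {cE cΛ cR cK cQ cE₂ cJ4 cΛ₂ cR₂ cQ₂ x₀ ωgl ωgh : ℕ → ℝ} {WE WJ WΛ WR WQ : ℕ → TableR} {N : ℝ}
  {μ ν : Fin 4}

/-- [folklore] **THE (REST′) LINE OF `RoadEndBFxRecut.d1Drift_BFx_recut` FOR THE CROSS WORD, PACKAGED** (`τ = inr (inr (inr (inr 1)))`, `lam n = n⁸`,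
profile `gp n b`): from a leg FAMILY `G` with an3's budget `DG 3 2 G`, membership `gp n b = G n (e n b)` on the base points, and the END's own `hlam`,
ONE constant serves every block size: `∃ A ≥ 0, ∀ n ≥ 2, |Σ_{b ∈ image resSite} n⁻⁴·fullSum (w ↦ restK' n a (gp n b) … (n⁸) N μ ν b τ w)| ≤ 2N²·(80·A)`. -/
theorem hRest_crossE'_packaged {G : Fam} (hG : DG 3 2 G) {e : ℕ → Pt → ℕ}
    (hmem : ∀ n : ℕ, 2 ≤ n → ∀ b ∈ (univ : Finset (Fin 4 → Fin n)).image resSite, gp n b = G n (e n b))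
    (hlam : ∀ n : ℕ, 2 ≤ n → ωgl n * cE n ^ 2 = 2 * N ^ 2 * (n : ℝ) ^ 8) :
    ∃ A : ℝ, 0 ≤ A ∧ ∀ n : ℕ, 2 ≤ n → ∀ [NeZero n],
      |∑ b ∈ (univ : Finset (Fin 4 → Fin n)).image resSite, ((n : ℝ) ^ 4)⁻¹ *
        fullSum (fun w : Pt => restK' n a (gp n b) (cE n) (cΛ n) (cR n) (cK n) (cQ n) (cE₂ n) (cJ4 n) (cΛ₂ n) (cR₂ n) (cQ₂ n) (x₀ n)
          (WE n) (WJ n) (WΛ n) (WR n) (WQ n) (ωgl n) (ωgh n) ((n : ℝ) ^ 8) N μ ν b (Sum.inr (Sum.inr (Sum.inr (Sum.inr 1)))) w)| ≤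
        2 * N ^ 2 * (80 * A) := by
  obtain ⟨A, hA, h⟩ := hR_remK₃_packaged_of_weight (cE := cE) (ωgl := ωgl) (μ := μ) (ν := ν) hG hmem (Ω := 2 * N ^ 2)
    (fun n hn => (weight_eq_of_hlam (by omega) (hlam n hn)).le)
  refine ⟨A, hA, fun n hn _ => ?_⟩
  have e : ∀ b : Pt, (fun w : Pt => restK' n a (gp n b) (cE n) (cΛ n) (cR n) (cK n) (cQ n) (cE₂ n) (cJ4 n) (cΛ₂ n) (cR₂ n) (cQ₂ n) (x₀ n)
      (WE n) (WJ n) (WΛ n) (WR n) (WQ n) (ωgl n) (ωgh n) ((n : ℝ) ^ 8) N μ ν b (Sum.inr (Sum.inr (Sum.inr (Sum.inr 1)))) w) =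
        remK₃ n (gp n b) (cE n) (ωgl n) μ ν := fun b => restK'_crossE_eq_remK₃ n (gp n b) (cE n) (ωgl n) μ ν b _ _ _ _ _ _ _ _ _ _ _ _ _ _ _ _ _ _ _
  simp only [e]
  exact h n hn

end RoadEnd

end Summit.QuantumFields.BalabanUV.Beta.D1BFx.CrossERecut

end
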